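import Summits.Ventures.CertifiedManyBodySolver.Downfold.EmeryThermalSeam
import Summits.Ventures.CertifiedManyBodySolver.Certificates.EmeryCu4O8_kryFam_SLCO_c3hh
import Summits.Ventures.CertifiedManyBodySolver.Downfold.EmeryBoxesYBCO6K26ThermalCapRetiltMarkovBoxp1
import HarnessLib

/-!
# `T > 0` FLOOR ATLAS WORD + TWO-SIDED THERMAL WINDOWS on YBa2Cu3O6.00 (M64; #139 bilayer PARENT) plane Cu(2) — U-SLICE «(K) 66» (U_dd, U_pp) = (5.0 — `emeryBoxYBCO6K26` (router/EMERY-FLOOR-ORDERS row 44; cap-only object of COVERAGE batches 3–5)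

Venture CertifiedManyBodySolver, cell `pub/hubbard-downfold` (S1 = ROUTER) × crew hubbard-fast S2 (ii) × (iv) «T > 0 × multi-band» (D-0096 (ii)); seat hubbard-downfold-mod-4
(S1/S2 Emery seam, g17). Namespace `Summit.Ventures.CertifiedManyBodySolver.Downfold`. THE POINT: this object carried a certified `T = 0` floor word
(`EmeryBoxesYBCO6K26FloorWord`), a `T > 0` CAP word (`EmeryBoxesYBCO6K26ThermalCapWord`, `emeryBoxYBCO6K26_pressureCap_m93o10`: `P_cell ≤ 6 log 2 + 43.4438·β`) and hubbard-box-p1's re-tilted / entropy-resolved twins (`EmeryBoxesYBCO6K26ThermalCapRetiltMarkovBoxp1`: `40.2438·β + 6 log 2`, Markov constant),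
but NO `T > 0` FLOOR — «no Rayleigh family exists for this object». None is needed: hubbard-box-p2's landed KLDL-R families `Certificates/EmeryCu4O8_kryFam_*`
(33 exactly orthonormal families of `Cu₄O₈` cluster vectors with exact rational traces, built for OTHER boxes' corners) are GLOBAL — a family's energy trace is affine in the
14 cluster couplings, so `holdsOn_emeryCellPressureFloor_of_rayleighTraces` (`EmeryThermalSeam` §3, Gibbs–Peierls on the span of the family) applies on ANY typed box at ANY level;
only the closed-form box bound `affineCapBound` (§1) is object-specific. ATLAS CHOICE (pure rational arithmetic over all 33 families on this box at εp = -93/10;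
generator `floor-orders/gen/make_thermal_flooratlas_file.py`, zero kit): best family **`kryFam_SLCO_c3hh`** (members N = 20, 21; box bounds C = (-142.264191, -142.691598),
rounded UP to 10⁻⁶ ⇒ weaker floor, sound); ranking (min over members, cluster units):
* `kryFam_SLCO_c3hh` (N = 20, 21): members -142.264, -142.692
* `kryFam_SLCO_c1hl` (N = 20, 21): members -142.252, -142.681
* `kryFam_SLCO_c2lh` (N = 20, 21): members -142.241, -142.677
* `kryFam_SLCO_c0ll` (N = 20, 21): members -142.224, -142.662
* `kryFam_La214_c0ll` (N = 19, 20, 21): members -140.359, -142.157, -142.620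
* `kryFam_La214_c1hl` (N = 19, 20, 21): members -140.177, -141.999, -142.522

RESULT (§2–§3): **`emeryBoxYBCO6K26_pressureFloorFam_m93o10`** `¼·log(Σⱼ e^{−βCⱼ}) ≤ P_cell` on the whole box, every β ≥ 0 (linear reading `35.6729·β ≤ P_cell`), hence the
object's FIRST TWO-SIDED `T > 0` WINDOWS: **`emeryBoxYBCO6K26_pressureWindow_m93o10`** `35.6729·β ≤ P_cell ≤ 43.4438·β + 6 log 2` and **`emeryBoxYBCO6K26_pressureWindow_m93o10_retilt`** `35.6729·β ≤ P_cell ≤ 40.2438·β + 6 log 2` (slope gap 4.5709 per CuO₂ per unit β; the Markov twin `emeryBoxYBCO6K26_pressureCap_m93o10_markov` tightens only the constant `6 log 2 → log 15` asymptotically and pairs with the same floor).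

Everything PROVED (0 sorry); no definition. HONEST FRAMING: CERTIFIED inequalities on a SCREENING/EXTRAPOLATED-grade object (U-slice / companion per router/EMERY-LINE-ROWS.tsv;
box ends [float]/DFT with locators in the router's BOXES files); the floor is a 2-sector Gibbs–Peierls bound from a trial family optimised for ANOTHER box (its slope sits
below this object's own `T = 0` floor word by the family's variational slack), the cap keeps the full entropy; thermal scales are NOT resolved (`k_BT ≪` widths);
grand-canonical statements at the stated level (the filling is not fixed); no phase word; no router number moves. WHAT-THIS-IS-NOT: a new certificate or a number of record —
a reading of EXISTING kernel objects through EXISTING doors (zero kit).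
-/

noncomputable section

namespace Summit.Ventures.CertifiedManyBodySolver.Downfold

open NonemptyInterval Matrix Finset Literature.Probability.LatticeModels
open Literature.MathematicalPhysics.QuantumLattice Literature.Computation.Certificates
open Summit.Ventures.CertifiedManyBodySolver.Certificates OccupationCode ClusterLowerBound
open scoped BigOperators ComplexOrder

/-! ## §1 Closed-form box bounds of the atlas family `kryFam_SLCO_c3hh` on `emeryBoxYBCO6K26` at εp = -93/10 -/

/-- Closed-form box bound of member 0 (`kry_SLCO_c3hh_s10x10`, N = 20) of `kryFam_SLCO_c3hh` on `emeryBoxYBCO6K26` at εp = -93/10: `≤ -142264191/1000000` (-142.264191; cluster units = 4 cells). [folklore] -/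
theorem yBCO6K26Atlas_SLCO_c3hh_m93o10_cap0 :
    affineCapBound cuprateSigns (fun a => ((kryFam_SLCO_c3hh_S 0 a : ℤ) : ℝ) / ((kryFam_SLCO_c3hh_NN 0 : ℤ) : ℝ)) (emeryLo (-93/10) ybco6K26Emery_tpd ybco6K26Emery_tpp ybco6K26Emery_Delta ybco6K26Emery_Udd ybco6K26Emery_Upp) (emeryHi (-93/10) ybco6K26Emery_tpd ybco6K26Emery_tpp ybco6K26Emery_Delta ybco6K26Emery_Udd ybco6K26Emery_Upp) ≤ (-142264191/1000000 : ℝ) := by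
  simp only [kryFam_SLCO_c3hh_S, kryFam_SLCO_c3hh_NN, affineCapBound, emeryLo, emeryHi, lineCoeff, kry_SLCO_c3hh_s10x10_S, cuprateSigns, ybco6K26Emery_tpd, ybco6K26Emery_tpp, ybco6K26Emery_Delta, ybco6K26Emery_Udd, ybco6K26Emery_Upp,
    Entry.encl_ofEnds_fst, Entry.encl_ofEnds_snd, Fin.sum_univ_succ, Fin.sum_univ_zero,
    Matrix.cons_val_zero, Matrix.cons_val_one, Matrix.cons_val_two, Matrix.cons_val, Matrix.head_cons, Matrix.tail_cons]
  push_cast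
  norm_num [max_def]

/-- Closed-form box bound of member 1 (`kry_SLCO_c3hh_s10x11`, N = 21) of `kryFam_SLCO_c3hh` on `emeryBoxYBCO6K26` at εp = -93/10: `≤ -71345799/500000` (-142.691598; cluster units = 4 cells). [folklore] -/
theorem yBCO6K26Atlas_SLCO_c3hh_m93o10_cap1 :
    affineCapBound cuprateSigns (fun a => ((kryFam_SLCO_c3hh_S 1 a : ℤ) : ℝ) / ((kryFam_SLCO_c3hh_NN 1 : ℤ) : ℝ)) (emeryLo (-93/10) ybco6K26Emery_tpd ybco6K26Emery_tpp ybco6K26Emery_Delta ybco6K26Emery_Udd ybco6K26Emery_Upp) (emeryHi (-93/10) ybco6K26Emery_tpd ybco6K26Emery_tpp ybco6K26Emery_Delta ybco6K26Emery_Udd ybco6K26Emery_Upp) ≤ (-71345799/500000 : ℝ) := by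
  simp only [kryFam_SLCO_c3hh_S, kryFam_SLCO_c3hh_NN, affineCapBound, emeryLo, emeryHi, lineCoeff, kry_SLCO_c3hh_s10x11_S, cuprateSigns, ybco6K26Emery_tpd, ybco6K26Emery_tpp, ybco6K26Emery_Delta, ybco6K26Emery_Udd, ybco6K26Emery_Upp,
    Entry.encl_ofEnds_fst, Entry.encl_ofEnds_snd, Fin.sum_univ_succ, Fin.sum_univ_zero,
    Matrix.cons_val_zero, Matrix.cons_val_one, Matrix.cons_val_two, Matrix.cons_val, Matrix.head_cons, Matrix.tail_cons]
  push_cast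
  norm_num [max_def]

/-! ## §2 The `T > 0` family floor on the whole box -/

/-- **`T > 0` ATLAS FAMILY FLOOR** on the whole `emeryBoxYBCO6K26`, cuprate signs, level εp = -93/10, EVERY β ≥ 0:
`¼·log(Σⱼ exp(−β·Cⱼ)) ≤ P_cell(β, θ_εp(p))` with `C = (-142264191/1000000, -71345799/500000)` = the closed-form box bounds of the 2 orthonormal members
(sectors N = 20, 21) of hubbard-box-p2's KLDL-R family `kryFam_SLCO_c3hh` (built for another box; global in θ) — the log-sum-exp keeps the entropy of the 2 sectors.
[cite: Ruelle1969, §2.5–2.6] [cite: Israel1979, Lemma II.3.1] -/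
theorem emeryBoxYBCO6K26_pressureFloorFam_m93o10 {β : ℝ} (hβ : 0 ≤ β) :
    HoldsOn (fun p : EmeryCoord → ℝ =>
      Real.log (Real.exp (-(β * (-142264191/1000000 : ℝ))) + Real.exp (-(β * (-71345799/500000 : ℝ)))) / 4 ≤ emeryCellPressure β (emeryLine cuprateSigns (emeryLineCoords (((-93/10 : ℚ)) : ℝ) p))) emeryBoxYBCO6K26 := by
  have h := holdsOn_emeryCellPressureFloor_of_rayleighTraces (E := emeryBoxYBCO6K26) (εp := -93/10) (eA := ybco6K26Emery_tpd) (eB := ybco6K26Emery_tpp) (eD := ybco6K26Emery_Delta)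
    (eUd := ybco6K26Emery_Udd) (eUp := ybco6K26Emery_Upp) (by simp [emeryBoxYBCO6K26, emeryBoxYBCO6K26Src, Function.update]) (by simp [emeryBoxYBCO6K26, emeryBoxYBCO6K26Src, Function.update]) (Function.update_self _ _ _) (by simp [emeryBoxYBCO6K26, emeryBoxYBCO6K26Src, Function.update]) (by simp [emeryBoxYBCO6K26, emeryBoxYBCO6K26Src, Function.update]) cuprateSigns hβ
    (φ := fun i => ((kryFam_SLCO_c3hh i).unit : Fock (Orb (Fin 1 ×ₗ Fin 12)))) kryFam_SLCO_c3hh_orthonormal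
    (T := fun i a => ((kryFam_SLCO_c3hh_S i a : ℤ) : ℝ) / ((kryFam_SLCO_c3hh_NN i : ℤ) : ℝ)) kryFam_SLCO_c3hh_traces
  intro p hp
  have h' := h p hp
  simp only [Fin.sum_univ_two] at h'
  refine le_trans ?_ h'
  exact div_le_div_of_nonneg_right (Real.log_le_log (by positivity) (add_le_add (Real.exp_le_exp.2 (neg_le_neg (mul_le_mul_of_nonneg_left yBCO6K26Atlas_SLCO_c3hh_m93o10_cap0 hβ))) (Real.exp_le_exp.2 (neg_le_neg (mul_le_mul_of_nonneg_left yBCO6K26Atlas_SLCO_c3hh_m93o10_cap1 hβ))))) (by norm_num)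

/-- **Linear reading of the floor**: `β·71345799/2000000 ≤ P_cell` (35.6729·β; the best member alone, N = 21) on the whole box, every β ≥ 0. [cite: Ruelle1969, §2.5–2.6] -/
theorem emeryBoxYBCO6K26_pressureFloorLinear_m93o10 {β : ℝ} (hβ : 0 ≤ β) :
    HoldsOn (fun p : EmeryCoord → ℝ =>
      β * (71345799/2000000 : ℝ) ≤ emeryCellPressure β (emeryLine cuprateSigns (emeryLineCoords (((-93/10 : ℚ)) : ℝ) p))) emeryBoxYBCO6K26 := by
  intro p hp
  refine le_trans ?_ (emeryBoxYBCO6K26_pressureFloorFam_m93o10 hβ p hp)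
  have hk : β * (71345799/2000000 : ℝ) = Real.log (Real.exp (-(β * (-71345799/500000 : ℝ)))) / 4 := by
    rw [Real.log_exp]; ring
  rw [hk]
  refine div_le_div_of_nonneg_right (Real.log_le_log (by positivity) ?_) (by norm_num)
  nlinarith [Real.exp_pos (-(β * (-142264191/1000000 : ℝ)))]

/-! ## §3 The two-sided `T > 0` windows -/

/-- **TWO-SIDED `T > 0` WINDOW ON THE BOX** (hypothesis-free on both sides): level εp = -93/10, EVERY β ≥ 0, EVERY point of `emeryBoxYBCO6K26`:
`¼·log(Σⱼ e^{−βCⱼ}) ≤ P_cell ≤ 6 log 2 + β·1390203/32000` — floor = §2, cap = this seat's flat cap word (monotone level transfer of the four kgp1x5 corner certificates) `emeryBoxYBCO6K26_pressureCap_m93o10`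
(linear reading `35.6729·β ≤ P_cell ≤ 43.4438·β + 4.1589`, slope gap 7.7709 per CuO₂ per unit β). [cite: Israel1979, Thm. I.2.4] [cite: Ruelle1969, §2.5–2.6] -/
theorem emeryBoxYBCO6K26_pressureWindow_m93o10 {β : ℝ} (hβ : 0 ≤ β) :
    HoldsOn (fun p : EmeryCoord → ℝ =>
      Real.log (Real.exp (-(β * (-142264191/1000000 : ℝ))) + Real.exp (-(β * (-71345799/500000 : ℝ)))) / 4 ≤ emeryCellPressure β (emeryLine cuprateSigns (emeryLineCoords (((-93/10 : ℚ)) : ℝ) p)) ∧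
      emeryCellPressure β (emeryLine cuprateSigns (emeryLineCoords (((-93/10 : ℚ)) : ℝ) p)) ≤ 6 * Real.log 2 + β * (1390203/32000 : ℝ)) emeryBoxYBCO6K26 :=
  fun p hp => ⟨emeryBoxYBCO6K26_pressureFloorFam_m93o10 hβ p hp, by simpa using emeryBoxYBCO6K26_pressureCap_m93o10 hβ p hp⟩

/-- **Linear reading of the box window**: `β·71345799/2000000 ≤ P_cell ≤ 6 log 2 + β·1390203/32000` on the whole box, every β ≥ 0 (35.6729·β … 43.4438·β + 4.1589). [cite: Israel1979, Thm. I.2.4] -/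
theorem emeryBoxYBCO6K26_pressureWindow_m93o10_linear {β : ℝ} (hβ : 0 ≤ β) :
    HoldsOn (fun p : EmeryCoord → ℝ =>
      β * (71345799/2000000 : ℝ) ≤ emeryCellPressure β (emeryLine cuprateSigns (emeryLineCoords (((-93/10 : ℚ)) : ℝ) p)) ∧
      emeryCellPressure β (emeryLine cuprateSigns (emeryLineCoords (((-93/10 : ℚ)) : ℝ) p)) ≤ 6 * Real.log 2 + β * (1390203/32000 : ℝ)) emeryBoxYBCO6K26 :=
  fun p hp => ⟨emeryBoxYBCO6K26_pressureFloorLinear_m93o10 hβ p hp, (emeryBoxYBCO6K26_pressureWindow_m93o10 hβ p hp).2⟩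

/-- **TWO-SIDED `T > 0` WINDOW ON THE BOX — RE-TILTED CAP** (hypothesis-free on both sides): level εp = -93/10, EVERY β ≥ 0, EVERY point of `emeryBoxYBCO6K26`:
`¼·log(Σⱼ e^{−βCⱼ}) ≤ P_cell ≤ 6 log 2 + β·1287803/32000` — floor = §2, cap = hubbard-box-p1's RE-TILTED cap word (`EmeryBoxesYBCO6K26ThermalCapRetiltMarkovBoxp1`, sector-wise level transfer) `emeryBoxYBCO6K26_pressureCap_m93o10_retilt`
(linear reading `35.6729·β ≤ P_cell ≤ 40.2438·β + 4.1589`, slope gap 4.5709 per CuO₂ per unit β). [cite: Israel1979, Thm. I.2.4] [cite: Ruelle1969, §2.5–2.6] -/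
theorem emeryBoxYBCO6K26_pressureWindow_m93o10_retilt {β : ℝ} (hβ : 0 ≤ β) :
    HoldsOn (fun p : EmeryCoord → ℝ =>
      Real.log (Real.exp (-(β * (-142264191/1000000 : ℝ))) + Real.exp (-(β * (-71345799/500000 : ℝ)))) / 4 ≤ emeryCellPressure β (emeryLine cuprateSigns (emeryLineCoords (((-93/10 : ℚ)) : ℝ) p)) ∧
      emeryCellPressure β (emeryLine cuprateSigns (emeryLineCoords (((-93/10 : ℚ)) : ℝ) p)) ≤ 6 * Real.log 2 + β * (1287803/32000 : ℝ)) emeryBoxYBCO6K26 :=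
  fun p hp => ⟨emeryBoxYBCO6K26_pressureFloorFam_m93o10 hβ p hp, by simpa using emeryBoxYBCO6K26_pressureCap_m93o10_retilt hβ p hp⟩

/-- **Linear reading of the re-tilted box window**: `β·71345799/2000000 ≤ P_cell ≤ 6 log 2 + β·1287803/32000` on the whole box, every β ≥ 0 (35.6729·β … 40.2438·β + 4.1589). [cite: Israel1979, Thm. I.2.4] -/
theorem emeryBoxYBCO6K26_pressureWindow_m93o10_retilt_linear {β : ℝ} (hβ : 0 ≤ β) :
    HoldsOn (fun p : EmeryCoord → ℝ =>
      β * (71345799/2000000 : ℝ) ≤ emeryCellPressure β (emeryLine cuprateSigns (emeryLineCoords (((-93/10 : ℚ)) : ℝ) p)) ∧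
      emeryCellPressure β (emeryLine cuprateSigns (emeryLineCoords (((-93/10 : ℚ)) : ℝ) p)) ≤ 6 * Real.log 2 + β * (1287803/32000 : ℝ)) emeryBoxYBCO6K26 :=
  fun p hp => ⟨emeryBoxYBCO6K26_pressureFloorLinear_m93o10 hβ p hp, (emeryBoxYBCO6K26_pressureWindow_m93o10_retilt hβ p hp).2⟩

end Summit.Ventures.CertifiedManyBodySolver.Downfold

end
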